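import Literature.AlgebraicGeometry.Resolution.IsolationIndexed
import HarnessLib

/-!
# (K-Φ3) label propagation IV: `δ > 1` is the ideal-theoretic condition `J ⊆ (y)^μ + 𝔪^{μ+1}` (indexed polygon, expansion-free)

Cell `res-dim4-pi` (D-0157 DOOR 2), Φ = β_h line of res-dim4-idea-1 (CARD I-1-6/7/8), kernel target (K-Φ3) of
`pub/res-dim4/res-dim4-idea-1/lean-g5/Sketch.lean` (ade7af20c994a8b6): the binder `hδ : μ! < deltaS (s k) (J k) μ` («`δ > 1`», the frame is
a LABEL) of `PhiLine.keepCount_add_betaS_le`. For the ARRIVAL frame this is memo §6.2 (P2) «the arrival frame is a label», whose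
form-level core is `…PhiLineLabelForm` («the tangent form involves no u-variable»). This file supplies the DICTIONARY between the
scaled polygon invariant and ideals, for every `r` and every regular local ring `R` of dimension `r + 2` with r.s.p.
`c = (y₁, …, y_r; u₁, u₂)` — the `Fin (r + 2)` form of the tree's `Fin 3` file `AdaptedSystems.lean` («`δ > 1 ⟺ cl_μ(J) ⊆ k·Y^μ`»,
CJS Def. 8.4 / (12.1), Cossart–Piltant 2008 §4 p. 12), stated WITHOUT initial forms:

* `weightedOrderIdeal_levelWeight_succ_le` — `F^{(L+1,…,L+1, L, L)}_{(L+1)μ}(c) ⊆ (y)^μ + 𝔪^{μ+1}` (`L = μ!`);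
* `yIdeal_pow_le_weightedOrderIdeal_levelWeight_succ`, `maximalIdeal_pow_succ_le_weightedOrderIdeal_levelWeight_succ`, and the
  equality `weightedOrderIdeal_levelWeight_succ_eq`;
* **`le_yIdeal_pow_sup_of_factorial_lt_deltaS`** — `δ > 1 ⇒ J ⊆ (y)^μ + 𝔪^{μ+1}`;
* **`factorial_lt_deltaS_of_le_yIdeal_pow_sup`** — `J ⊆ (y)^μ + 𝔪^{μ+1}` and a non-empty polygon `⇒ δ > 1`;
* **`factorial_lt_deltaS_iff`** — the equivalence (non-empty polygon).

So `hδ` for a frame `(y; u)` of the state `F = x^r·G` (ideal `J = (G)`, `μ = d = ord G`) reads «`G ∈ (y₁, y₂)^d + 𝔪^{d+1}`», i.e. the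
degree-`d` tangent form of `G` is a form in the linear parts of `y₁, y₂` — the conclusion of `PhiLine.killVars_eq_self_of_label_hypotheses`
in adapted linear coordinates. [OURS · counted 0 · AI work weaker than expert review.] Nothing here proves K2(p), the β_h line, or resolution
of singularities in dimension ≥ 4 / characteristic p.

Sources: V. Cossart, U. Jannsen, S. Saito, LNM **2270** (2020), Def. 8.4, Lemma 8.4 (1), (12.1) [`CossartJannsenSaito2020`]; V. Cossart,
O. Piltant, J. Algebra 320 (2008), §4 pp. 11–12 [`CossartPiltant2008`]. Tree: `Literature/AlgebraicGeometry/Resolution/AdaptedSystems.lean`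
(`Fin 3`), `IsolationIndexed.lean` (`yIdeal`, `weightedOrderIdeal_wKy_le` — the same estimate for the weight `(K,…,K,1,1)`).
-/

noncomputable section

open IsLocalRing MvPolynomial
open Literature.AlgebraicGeometry.Resolution (cmonom weightedOrderIdeal weightedOrderIdeal_antitone weightedOrderIdeal_mul_le
  weightedOrderIdeal_pow_le apply_mem_weightedOrderIdeal cmonom_mem_pow_degree)
open Literature.AlgebraicGeometry.Resolution.WeightedOrder

set_option linter.dupNamespace false

namespace Summit.ResolutionOfSingularities.ResolutionOfSingularities.Theorems.PIDim4.PhiLine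

universe u

section DeltaLabel

variable {R : Type u} [CommRing R] {r : ℕ} (c : Fin (r + 2) → R) (μ : ℕ)

/-- **`F^{(L+1,…,L+1,L,L)}_{(L+1)μ}(c) ⊆ (y)^μ + 𝔪^{μ+1}`** (`L = μ!`): a monomial `y^B u^A` of level weight `(L+1)|B| + L|A| ≥ (L+1)μ`
has `|B| ≥ μ` or `|A| + |B| ≥ μ + 1`. [cite: CossartJannsenSaito2020, Def. 8.4] [cite: CossartPiltant2008, §4 p. 12] -/
theorem weightedOrderIdeal_levelWeight_succ_le [IsLocalRing R] (hgen : Ideal.span (Set.range c) = maximalIdeal R) :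
    weightedOrderIdeal c (levelWeight μ (μ.factorial + 1) 1 1) ((μ.factorial + 1) * μ) ≤ yIdeal c ^ μ ⊔ maximalIdeal R ^ (μ + 1) := by
  rw [weightedOrderIdeal, Ideal.span_le]
  rintro _ ⟨e, he, rfl⟩
  replace he : (μ.factorial + 1) * μ ≤ _ := he
  rw [weight_levelWeight] at he
  rw [SetLike.mem_coe]
  by_cases h : μ ≤ ydeg e
  · rw [cmonom_eq_yPart_mul]
    refine Ideal.mem_sup_left (Ideal.mul_mem_right _ _ (Ideal.mul_mem_right _ _ ?_))
    exact Ideal.pow_le_pow_right h (prod_yPart_pow_mem c e fun i => Ideal.subset_span ⟨i, rfl⟩)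
  · push Not at h
    have hdeg : μ + 1 ≤ e.degree := by
      rw [degree_eq_ydeg_add]
      by_contra hlt
      push Not at hlt
      have h1 : ydeg e + (e (u1 r) + e (u2 r)) ≤ μ := by omega
      have h2 : μ.factorial * (1 * e (u1 r) + 1 * e (u2 r)) ≤ μ.factorial * (μ - ydeg e) := Nat.mul_le_mul_left _ (by omega)
      have h3 : (μ.factorial + 1) * ydeg e + μ.factorial * (μ - ydeg e) < (μ.factorial + 1) * μ := by
        have hsplit : (μ.factorial + 1) * μ = (μ.factorial + 1) * ydeg e + (μ.factorial + 1) * (μ - ydeg e) := by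
          rw [← Nat.mul_add]; congr 1; omega
        rw [hsplit]
        have : 0 < μ - ydeg e := by omega
        nlinarith
      omega
    refine Ideal.mem_sup_right (Ideal.pow_le_pow_right hdeg ?_)
    exact cmonom_mem_pow_degree c (maximalIdeal R) (fun i => hgen ▸ Ideal.subset_span ⟨i, rfl⟩) e

/-- Powers of an ideal inside `F_a` lie inside `F_{k a}`. [cite: CossartJannsenSaito2020, Def. 7.2 (1)] -/
theorem pow_le_weightedOrderIdeal_mul {σ : Type*} (c' : σ → R) (w : σ → ℕ) {I : Ideal R} {a : ℕ}
    (hI : I ≤ weightedOrderIdeal c' w a) (k : ℕ) : I ^ k ≤ weightedOrderIdeal c' w (k * a) :=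
  (Ideal.pow_right_mono hI k).trans (weightedOrderIdeal_pow_le c' w a k)

/-- `(y)^μ ⊆ F^{(L+1,…,L+1,L,L)}_{(L+1)μ}(c)`: each `y_j` has level weight `L + 1`. [cite: CossartJannsenSaito2020, Def. 8.4] -/
theorem yIdeal_pow_le_weightedOrderIdeal_levelWeight_succ :
    yIdeal c ^ μ ≤ weightedOrderIdeal c (levelWeight μ (μ.factorial + 1) 1 1) ((μ.factorial + 1) * μ) := by
  have h1 : yIdeal c ≤ weightedOrderIdeal c (levelWeight μ (μ.factorial + 1) 1 1) (μ.factorial + 1) := by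
    rw [yIdeal, Ideal.span_le]
    rintro _ ⟨i, rfl⟩
    have := apply_mem_weightedOrderIdeal c (levelWeight μ (μ.factorial + 1) 1 1) (Fin.castAdd 2 i)
    rwa [levelWeight_y] at this
  rw [Nat.mul_comm]
  exact pow_le_weightedOrderIdeal_mul c _ h1 μ

/-- `𝔪^{μ+1} ⊆ F^{(L+1,…,L+1,L,L)}_{(L+1)μ}(c)`: every generator has level weight `≥ L` and `(μ+1)L ≥ (L+1)μ`.
[cite: CossartJannsenSaito2020, Lemma 8.4 (1)] -/
theorem maximalIdeal_pow_succ_le_weightedOrderIdeal_levelWeight_succ [IsLocalRing R]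
    (hgen : Ideal.span (Set.range c) = maximalIdeal R) :
    maximalIdeal R ^ (μ + 1) ≤ weightedOrderIdeal c (levelWeight μ (μ.factorial + 1) 1 1) ((μ.factorial + 1) * μ) := by
  have hL : maximalIdeal R ≤ weightedOrderIdeal c (levelWeight μ (μ.factorial + 1) 1 1) μ.factorial := by
    rw [← hgen, Ideal.span_le]
    rintro _ ⟨i, rfl⟩
    refine weightedOrderIdeal_antitone c _ ?_ (apply_mem_weightedOrderIdeal c (levelWeight μ (μ.factorial + 1) 1 1) i)
    refine Fin.addCases (fun j => ?_) (fun j => ?_) i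
    · rw [levelWeight_y]; omega
    · fin_cases j
      · change μ.factorial ≤ levelWeight μ _ 1 1 (u1 r); rw [levelWeight_u1]; omega
      · change μ.factorial ≤ levelWeight μ _ 1 1 (u2 r); rw [levelWeight_u2]; omega
  refine (Ideal.pow_right_mono hL (μ + 1)).trans ((weightedOrderIdeal_pow_le c _ _ (μ + 1)).trans
    (weightedOrderIdeal_antitone c _ ?_))
  have := Nat.self_le_factorial μ
  nlinarith

/-- **`F^{(L+1,…,L+1,L,L)}_{(L+1)μ}(c) = (y)^μ + 𝔪^{μ+1}`.** [cite: CossartJannsenSaito2020, Def. 8.4] -/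
theorem weightedOrderIdeal_levelWeight_succ_eq [IsLocalRing R] (hgen : Ideal.span (Set.range c) = maximalIdeal R) :
    weightedOrderIdeal c (levelWeight μ (μ.factorial + 1) 1 1) ((μ.factorial + 1) * μ) = yIdeal c ^ μ ⊔ maximalIdeal R ^ (μ + 1) :=
  le_antisymm (weightedOrderIdeal_levelWeight_succ_le c μ hgen)
    (sup_le (yIdeal_pow_le_weightedOrderIdeal_levelWeight_succ c μ)
      (maximalIdeal_pow_succ_le_weightedOrderIdeal_levelWeight_succ c μ hgen))

variable [IsRegularLocalRing R] (hgen : Ideal.span (Set.range c) = maximalIdeal R) (hdim : ringKrullDim R = r + 2) {J : Ideal R}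

include hgen hdim in
/-- **`δ > 1 ⇒ J ⊆ (y)^μ + 𝔪^{μ+1}`** (scaled: `μ! < deltaS c J μ`): every Newton point of `y`-degree `< μ` has `x₁ + x₂ ≥ δ > 1`, so `J`
lies in the level-weight ideal of the line `x₁ + x₂ = 1 + 1/L` (bridge `le_weightedOrderIdeal_levelWeight_iff`), which is
`(y)^μ + 𝔪^{μ+1}`. [cite: CossartJannsenSaito2020, Def. 8.4] [cite: CossartPiltant2008, §4 p. 12] -/
theorem le_yIdeal_pow_sup_of_factorial_lt_deltaS (hδ : μ.factorial < deltaS c J μ) :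
    J ≤ yIdeal c ^ μ ⊔ maximalIdeal R ^ (μ + 1) := by
  have h := (le_weightedOrderIdeal_levelWeight_iff c hgen hdim J (μ := μ) (w₀ := μ.factorial + 1) (by omega) Nat.one_pos
    Nat.one_pos).mpr fun e he => by have := deltaS_le he; omega
  exact h.trans (weightedOrderIdeal_levelWeight_succ_le c μ hgen)

include hgen hdim in
/-- **`J ⊆ (y)^μ + 𝔪^{μ+1}` and a non-empty polygon `⇒ δ > 1`.** [cite: CossartJannsenSaito2020, Def. 8.4] [cite: CossartPiltant2008, §4 p. 12] -/
theorem factorial_lt_deltaS_of_le_yIdeal_pow_sup (hJ : J ≤ yIdeal c ^ μ ⊔ maximalIdeal R ^ (μ + 1)) (hne : (pts c J μ).Nonempty) :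
    μ.factorial < deltaS c J μ := by
  have h := (le_weightedOrderIdeal_levelWeight_iff c hgen hdim J (μ := μ) (w₀ := μ.factorial + 1) (by omega) Nat.one_pos
    Nat.one_pos).mp (hJ.trans (by rw [weightedOrderIdeal_levelWeight_succ_eq c μ hgen]))
  obtain ⟨e, he, hsum⟩ := exists_pts_deltaS hne
  have := h e he
  rw [← hsum]; omega

include hgen hdim in
/-- **`δ > 1 ⟺ J ⊆ (y)^μ + 𝔪^{μ+1}`** for a non-empty polygon — the `hδ` binder of the Sketch as an ideal membership («the frame is a
label»: the degree-`μ` tangent forms of `J` are forms in the linear parts of the `y`'s). [cite: CossartJannsenSaito2020, Def. 8.4]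
[cite: CossartPiltant2008, §4 p. 12] -/
theorem factorial_lt_deltaS_iff (hne : (pts c J μ).Nonempty) :
    μ.factorial < deltaS c J μ ↔ J ≤ yIdeal c ^ μ ⊔ maximalIdeal R ^ (μ + 1) :=
  ⟨le_yIdeal_pow_sup_of_factorial_lt_deltaS c μ hgen hdim, fun h => factorial_lt_deltaS_of_le_yIdeal_pow_sup c μ hgen hdim h hne⟩

include hgen hdim in
/-- Principal case `J = (g)`: `δ((g), μ) > 1 ⟺ g ∈ (y)^μ + 𝔪^{μ+1}` (non-empty polygon). [cite: CossartJannsenSaito2020, Def. 8.4] -/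
theorem factorial_lt_deltaS_span_singleton_iff {g : R} (hne : (pts c (Ideal.span {g}) μ).Nonempty) :
    μ.factorial < deltaS c (Ideal.span {g}) μ ↔ g ∈ yIdeal c ^ μ ⊔ maximalIdeal R ^ (μ + 1) := by
  rw [factorial_lt_deltaS_iff c μ hgen hdim hne, Ideal.span_singleton_le_iff_mem]

end DeltaLabel

end Summit.ResolutionOfSingularities.ResolutionOfSingularities.Theorems.PIDim4.PhiLine

end
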